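import Literature.MathematicalPhysics.QuantumFieldTheory.ConformalBootstrap3D.PointCertificateTableLower

/-!
# The table theorem with an unbounded `Δ_ε`-range

`boxExcluded_of_pointTable₂` asks `Q ⊆ [s_lo, s_hi] × ([ε_lo, ε_hi) ∪ [t₀₀, E₀))`: the light-block
obligation (O2) at `(Δ_ε, ℓ = 0)` is read off a head cell, and head cells stop at `E₀`. But for
`Δ_ε ≥ E₀` the obligation is ALREADY covered by the certificate's tail rules — (M) on `[E₀, E_T)`
and the apex inequality (T) give block positivity at every `(Δ, ℓ)` with `Δ ≥ E₀`
(`tail_nonneg_pointFunctional_of_termwise_and_apex_twist`), in particular at `ℓ = 0`. So the SAME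
finite table certifies the box with the scalar row's range extended to `[t₀₀, ∞)`: the production
strips `{column} × [1.5, ∞)` and windows `W = [σ_lo, σ_hi] × [0.6, ∞)` of pub-ising3d are then
literal instances (`boxExcluded_of_pointRules_twist_unbounded`, `boxExcluded_of_pointTable₂_unbounded`;
one extra trivial check `1/2 ≤ E₀`). Term basis: Hogervorst–Rychkov 2013, §3 eq. (3.6).
[cite: HogervorstRychkov2013, §3 eq. (3.6)]
-/

noncomputable section

namespace Literature.MathematicalPhysics.QuantumFieldTheory.ConformalBootstrap3D

open Finset Set

/-- **Point-functional schema, twist domain, (O2) only below `E₀`.** As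
`boxExcluded_of_pointRules_twist`, but the `ε`-obligation (O2) is required only for `Δ_ε < E₀`;
for `Δ_ε ≥ E₀ (≥ 1/2)` it follows from (M)+(T) through the tail theorem at `ℓ = 0`.
[cite: HogervorstRychkov2013, §3 eq. (3.6)] -/
theorem boxExcluded_of_pointRules_twist_unbounded {N : ℕ} {w z zb : Fin N → ℝ}
    (hz : ∀ k, z k ∈ Ioo (0 : ℝ) 1) (hzb : ∀ k, zb k ∈ Ioo (0 : ℝ) 1) (hord : ∀ k, zb k ≤ z k)
    (a : Fin N) (ha : 0 ≤ w a) (qd qr : Fin N → ℝ) (hqd : ∀ k, 0 < qd k ∧ qd k ≤ 1)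
    (hqr : ∀ k, 0 < qr k ∧ qr k ≤ 1)
    (hdomd : ∀ k, z k * zb k ≤ qd k ^ 2 * (z a * zb a) ∧ z k ≤ qd k * z a)
    (hdomr : ∀ k, (1 - z k) * (1 - zb k) ≤ qr k ^ 2 * (z a * zb a) ∧ 1 - zb k ≤ qr k * z a)
    {Q : Set (ℝ × ℝ)} {slo shi E₀ ET τ : ℝ} (hQ : ∀ p ∈ Q, slo ≤ p.1 ∧ p.1 ≤ shi)
    (hτ1 : τ ≤ 1) (hτ0 : τ ≤ E₀) (hE0 : 1 / 2 ≤ E₀)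
    (hI : 0 < termCornerBound w z zb 0 0 0 slo shi)
    (hO2 : ∀ p ∈ Q, p.2 < E₀ → BlockPositive (pointFunctional w z zb) p.1 p.2 0)
    (hO3 : ∀ p ∈ Q, ∀ Δ : ℝ, 3 ≤ Δ → Δ < E₀ → BlockPositive (pointFunctional w z zb) p.1 Δ 0)
    (hO4 : ∀ p ∈ Q, ∀ ℓ : ℕ, Even ℓ → ℓ ≠ 0 → ∀ Δ : ℝ, (ℓ : ℝ) + 1 ≤ Δ → Δ < E₀ →
      BlockPositive (pointFunctional w z zb) p.1 Δ ℓ)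
    (hM : ∀ (j : ℕ) (E : ℝ), E₀ ≤ E → E < ET → (j : ℝ) + τ ≤ E → ∀ p ∈ Q,
      0 ≤ pointFunctional w z zb (crossF p.1 (-1) (zMono E j)))
    (hB : ∑ k ∈ univ.erase a, |w k| * ((1 - z k) * (1 - zb k)) ^ slo * qd k ^ ET
          + ∑ k, |w k| * (z k * zb k) ^ slo * qr k ^ ET ≤ w a * ((1 - z a) * (1 - zb a)) ^ shi) :
    BoxExcluded Q := by
  refine boxExcluded_of_pointRules_twist hz hzb hord a ha qd qr hqd hqr hdomd hdomr hQ hτ1 hτ0 hI ?_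
    hO3 hO4 hM hB
  intro p hp
  by_cases h : p.2 < E₀
  · exact hO2 p hp h
  · have hb0 : unitarityBound3D 0 ≤ p.2 := by
      have : unitarityBound3D 0 = 1 / 2 := by simp [unitarityBound3D]
      rw [this]; linarith [not_lt.1 h]
    exact tail_nonneg_pointFunctional_of_termwise_and_apex_twist w z zb hz hzb hord a ha qd qr hqd
      hqr hdomd hdomr hQ hτ1 hτ0 hM hB p hp 0 p.2 hb0 (not_lt.1 h)

/-- **The two-row table with the scalar row's `Δ_ε`-range extended to `[t₀₀, ∞)`.** Exactly the
data and checks of `boxExcluded_of_pointTable₂` plus `1/2 ≤ E₀`, for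
`Q ⊆ [s_lo, s_hi] × ([ε_lo, ε_hi) ∪ [t₀₀, ∞))`. [cite: HogervorstRychkov2013, §3 eq. (3.6)] -/
theorem boxExcluded_of_pointTable₂_unbounded {N : ℕ} {w z zb : Fin N → ℝ}
    (hz : ∀ k, z k ∈ Ioo (0 : ℝ) 1) (hzb : ∀ k, zb k ∈ Ioo (0 : ℝ) 1) (hord : ∀ k, zb k ≤ z k)
    (apex : Fin N) (hapex : 0 ≤ w apex) (qd qr : Fin N → ℝ) (hqd : ∀ k, 0 < qd k ∧ qd k ≤ 1)
    (hqr : ∀ k, 0 < qr k ∧ qr k ≤ 1)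
    (hdomd : ∀ k, z k * zb k ≤ qd k ^ 2 * (z apex * zb apex) ∧ z k ≤ qd k * z apex)
    (hdomr : ∀ k, (1 - z k) * (1 - zb k) ≤ qr k ^ 2 * (z apex * zb apex) ∧
      1 - zb k ≤ qr k * z apex)
    {Q : Set (ℝ × ℝ)} {slo shi εlo εhi E₀ ET τ : ℝ}
    (t : ℕ → ℕ → ℝ) (K : ℕ → ℕ) (nF : ℕ → ℕ → ℕ) (hc hi : ℕ → ℕ → Bool)
    (tε : ℕ → ℝ) (Kε : ℕ) (nFε : ℕ → ℕ) (hcε hiε : ℕ → Bool)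
    (hQ : ∀ p ∈ Q, (slo ≤ p.1 ∧ p.1 ≤ shi) ∧ ((εlo ≤ p.2 ∧ p.2 < εhi) ∨ t 0 0 ≤ p.2))
    (L : ℕ) (hL : E₀ ≤ (L : ℝ) + 1) (hτ1 : τ ≤ 1) (hτ0 : τ ≤ E₀) (hE0 : 1 / 2 ≤ E₀)
    (hr : ∀ k, 1 / 2 ≤ ((1 - z k) * (1 - zb k)) ^ (shi - slo) ∧ 1 / 2 ≤ (z k * zb k) ^ (shi - slo))
    -- (O1)
    (hI : 0 < termCornerBound w z zb 0 0 0 slo shi)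
    -- the ε-row (ℓ = 0)
    (htε : tε 0 = εlo ∧ tε Kε = εhi)
    (hlowε1 : ∀ k, k < Kε → hiε k = false → 1 ≤ tε k)
    (hlowεI : ∀ k, k < Kε → hiε k = true → 1 / 2 < tε k ∧ τ ≤ tε k)
    (hnFε : ∀ k, k < Kε → E₀ ≤ tε k + ((nFε k : ℝ) + 1))
    (hρε : ∀ k, k < Kε → hcε k = true → ∀ i, 1 / 2 ≤ (z i * zb i) ^ ((tε (k + 1) - tε k) / 2) ∧
      1 / 2 ≤ ((1 - z i) * (1 - zb i)) ^ ((tε (k + 1) - tε k) / 2))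
    (hheadε : ∀ k < Kε, 0 ≤ headNumber₂ w z zb 0 (tε k) (tε (k + 1)) slo shi (nFε k) (hcε k) (hiε k))
    -- the scalar row (ℓ = 0, from ≤ 3 to E₀) and the spinning rows (even 0 < ℓ < L, ℓ+1 to E₀)
    (ht0 : t 0 0 ≤ 3 ∧ t 0 (K 0) = E₀)
    (htℓ : ∀ ℓ, Even ℓ → ℓ ≠ 0 → ℓ < L → t ℓ 0 = (ℓ : ℝ) + 1 ∧ t ℓ (K ℓ) = E₀)
    (hlow1 : ∀ ℓ k, k < K ℓ → hi ℓ k = false → (ℓ : ℝ) + 1 ≤ t ℓ k)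
    (hlowI : ∀ ℓ k, k < K ℓ → hi ℓ k = true → unitarityBound3D ℓ < t ℓ k ∧ (ℓ : ℝ) + τ ≤ t ℓ k)
    (hnF : ∀ ℓ k, k < K ℓ → E₀ ≤ t ℓ k + ((nF ℓ k : ℝ) + 1))
    (hρ : ∀ ℓ k, k < K ℓ → hc ℓ k = true → ∀ i, 1 / 2 ≤ (z i * zb i) ^ ((t ℓ (k + 1) - t ℓ k) / 2) ∧
      1 / 2 ≤ ((1 - z i) * (1 - zb i)) ^ ((t ℓ (k + 1) - t ℓ k) / 2))
    (hhead : ∀ ℓ, (ℓ = 0 ∨ (Even ℓ ∧ ℓ < L)) → ∀ k < K ℓ,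
      0 ≤ headNumber₂ w z zb ℓ (t ℓ k) (t ℓ (k + 1)) slo shi (nF ℓ k) (hc ℓ k) (hi ℓ k))
    -- (M) box rows, twist-gap domain
    (e : ℕ → ℕ → ℝ) (M : ℕ → ℕ) (bc : ℕ → ℕ → Bool)
    (he : ∀ j : ℕ, (j : ℝ) + τ < ET → e j 0 ≤ max E₀ ((j : ℝ) + τ) ∧ ET ≤ e j (M j))
    (hρM : ∀ j m, m < M j → bc j m = true → ∀ k, 1 / 2 ≤ (z k * zb k) ^ ((e j (m + 1) - e j m) / 2) ∧
      1 / 2 ≤ ((1 - z k) * (1 - zb k)) ^ ((e j (m + 1) - e j m) / 2))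
    (hbox : ∀ j : ℕ, (j : ℝ) + τ < ET → ∀ m < M j,
      0 ≤ boxNumber w z zb j (e j m) (e j (m + 1)) slo shi (bc j m))
    -- (T)
    (hB : ∑ k ∈ univ.erase apex, |w k| * ((1 - z k) * (1 - zb k)) ^ slo * qd k ^ ET
          + ∑ k, |w k| * (z k * zb k) ^ slo * qr k ^ ET ≤
          w apex * ((1 - z apex) * (1 - zb apex)) ^ shi) :
    BoxExcluded Q := by
  have hQ1 : ∀ p ∈ Q, slo ≤ p.1 ∧ p.1 ≤ shi := fun p hp => (hQ p hp).1
  have hM := ruleM_of_boxTable_twist w z zb hz hzb τ hQ1 hr e M bc he hρM hbox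
  have hcell : ∀ ℓ, (ℓ = 0 ∨ (Even ℓ ∧ ℓ < L)) → ∀ k < K ℓ, ∀ p ∈ Q,
      ∀ Δ ∈ Ico (t ℓ k) (t ℓ (k + 1)), BlockPositive (pointFunctional w z zb) p.1 Δ ℓ :=
    fun ℓ hℓ k hk => cell_of_headNumber₂ w z zb hz hzb hord apex hapex qd qr hqd hqr hdomd hdomr
      hQ1 hτ1 hM hB hr (nF ℓ k) (hnF ℓ k hk) (hc ℓ k) (hi ℓ k) (hlow1 ℓ k hk) (hlowI ℓ k hk)
      (hρ ℓ k hk) (hhead ℓ hℓ k hk)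
  have hb0 : unitarityBound3D 0 = 1 / 2 := by simp [unitarityBound3D]
  have hcellε : ∀ k < Kε, ∀ p ∈ Q,
      ∀ Δ ∈ Ico (tε k) (tε (k + 1)), BlockPositive (pointFunctional w z zb) p.1 Δ 0 :=
    fun k hk => cell_of_headNumber₂ w z zb hz hzb hord apex hapex qd qr hqd hqr hdomd hdomr
      hQ1 hτ1 hM hB hr (nFε k) (hnFε k hk) (hcε k) (hiε k)
      (fun h => by simpa using hlowε1 k hk h)
      (fun h => by
        obtain ⟨h1, h2⟩ := hlowεI k hk h
        exact ⟨by rw [hb0]; exact h1, by simpa using h2⟩)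
      (hρε k hk) (hheadε k hk)
  refine boxExcluded_of_pointRules_twist_unbounded hz hzb hord apex hapex qd qr hqd hqr hdomd hdomr hQ1
    hτ1 hτ0 hE0 hI ?_ ?_ ?_ hM hB
  · -- (O2) below E₀: ε-row or scalar row
    intro p hp hlt
    rcases (hQ p hp).2 with hε | h0
    · exact blockPositive_of_cells_Ico tε Kε hcellε p hp p.2 ⟨htε.1 ▸ hε.1, htε.2 ▸ hε.2⟩
    · exact blockPositive_of_cells_Ico (t 0) (K 0) (hcell 0 (Or.inl rfl)) p hp p.2
        ⟨h0, ht0.2 ▸ hlt⟩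
  · exact scalar_nonneg_of_cells (t 0) (K 0) ht0.1 ht0.2 (hcell 0 (Or.inl rfl))
  · exact spinning_nonneg_of_cells L hL t K (fun ℓ hev hℓ hℓL => (htℓ ℓ hev hℓ hℓL).1.le)
      (fun ℓ hev hℓ hℓL => (htℓ ℓ hev hℓ hℓL).2)
      (fun ℓ hev hℓ hℓL => hcell ℓ (Or.inr ⟨hev, hℓL⟩))

end Literature.MathematicalPhysics.QuantumFieldTheory.ConformalBootstrap3D
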